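import Summits.CriticalPhenomena.SAWScalingLimit.Theorems.SAWDevelopingMapObservableToSLEChordalCarrierCollars
import Summits.CriticalPhenomena.SAWScalingLimit.Theorems.SAWDevelopingMapObservableToSLERestrictionIdentifiesHulls
import Literature.MeasureTheory.RandomSets.AvoidanceFunctional

/-!
# Crux `HexConjecture` (stmt-CriticalPhenomena-0808), line `root-locality-replaces-loewner`,
stub `stub_rangeIdentification`: BOUNDARY AVOIDANCE of subsequential limits of the range laws
(part 2c)

Landing target:
`Summits/CriticalPhenomena/SAWScalingLimit/Theorems/SAWDevelopingMapHexConjectureRangeIdentificationBoundary.lean`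
(`--supports stmt-CriticalPhenomena-0808`).

Let `ν` be a probability measure on `NonemptyCompacts ℂ` and `μ` the chordal SLE(8/3) law of the
Dobrushin domain `(D; a, b)` read through a chordal uniformizing map `φ` (a law carried by the
chordal carrier whose probability of avoiding `ψ(A)` is `Φ'_A(0)^{5/8}` for every `*`-hull `A`,
`ψ = φ.boundaryExtension`; `exists_sleLaw_through`, [LSW] Thm. 6.1).  Suppose (H1): for every hull
subdomain `D'` of `D`, `μ {range ⊆ cl D'} ≤ ν {K ⊆ cl D'}` — the inequality a subsequential limit
of the RANGE laws of the critical hexagonal SAW inherits, through the closed half of the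
portmanteau theorem, from the avoidance cocycle (part 1b).  THEN `ν`-a.e. compact set `K`
meets `∂D` only inside `{a, b}` (`ae_inter_frontier_subset`, registered as
`rangeIdentification_boundary`).

Proof: each boundary piece `frontierPiece D k = ∂D ∖ (B(a, 1/(k+1)) ∪ B(b, 1/(k+1)))` is covered by
two compact arcs `ψ[r, R]`, `ψ[-R, -r]` (`exists_Icc_cover_frontierPiece`); thin half-ellipse hulls
`J_j ∌ 0` over `[r/2, 2R]` with restriction derivatives `d_j → 1` (`exists_plusData`, and their
reflections `reflect_data`) are pull-backs of Jordan hull subdomains `D_j` whose closures miss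
the arc (`exists_hullSubdomain_collar`), so that
`ν {K ∩ arc = ∅} ≥ ν {K ⊆ cl D_j} ≥ μ {range ⊆ cl D_j} ≥ μ {range ∩ ψ(J_j) = ∅} = d_j^{5/8} → 1`
(a chord in `cl D` avoiding `ψ(A)`, `A` the pulled-back hull of `D'`, lies in `cl D'`:
`closure_diff_subset`, `diff_subset_image_pullbackHull`).  This is the technology of
`stub_chordalCarrier_collars` (crux item stmt-10472) transposed from curve limits with lattice
hull events to compact-set limits with the closed curve-space events of the avoidance cocycle.

References: G. F. Lawler, O. Schramm, W. Werner, J. Amer. Math. Soc. **16** (2003), §2 p. 8,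
Lemma 3.2, Thm. 6.1; Ch. Pommerenke, *Boundary Behaviour of Conformal Maps* (1992), Thm. 2.6.
-/

noncomputable section

namespace Summit.CriticalPhenomena.SAWScalingLimit.Theorems.HexConjecture.RootLocality.Range

open scoped Topology NNReal ENNReal
open Filter Set MeasureTheory TopologicalSpace Metric Complex
open UpperHalfPlane (upperHalfPlaneSet isOpen_upperHalfPlaneSet)
open Literature.Probability.RandomPlanarGeometry
open Summit.CriticalPhenomena.SAWScalingLimit.Theorems.ObservableToSLE.FloorRatio
  (exists_Icc_cover_frontierPiece exists_hullSubdomain_collar exists_plusData reflect_data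
    imagAxisRefl_image_ofReal_Icc closure_diff_subset diff_subset_image_pullbackHull
    isClosed_image_pullbackHull)

variable {D : DobrushinDomain} {φ : ConformalEquiv upperHalfPlaneSet D.carrier}

/-- **A chord of `cl D` avoiding `ψ(A)`, `A` the pulled-back hull of the hull subdomain `D'`, lies
in `cl D'`** (`D ∖ D' ⊆ ψ(A)` and `cl D ∖ ψ(A) ⊆ cl D'`). [folklore] -/
theorem rangeSubset_compl_image_pullbackHull_subset (hφ : D.IsChordalUniformizing φ)
    {D' : DobrushinDomain} (hD' : D.IsHullSubdomain D') :
    CurveClass.rangeSubset (φ.boundaryExtension '' φ.pullbackHull D')ᶜ ∩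
        CurveClass.rangeSubset (closure D.carrier) ⊆
      CurveClass.rangeSubset (closure D'.carrier) := by
  rintro c ⟨hc, hcD⟩
  rw [CurveClass.mem_rangeSubset] at hc hcD ⊢
  have hS : IsClosed (φ.boundaryExtension '' φ.pullbackHull D') :=
    isClosed_image_pullbackHull JordanDomain.isSimplyConnected_holds
      JordanDomain.exists_continuousOn_extension_holds hφ hD'
  exact fun x hx => closure_diff_subset hS diff_subset_image_pullbackHull ⟨hcD hx, hc hx⟩

section Boundary

variable [MeasurableSpace (NonemptyCompacts ℂ)] [BorelSpace (NonemptyCompacts ℂ)]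

omit [BorelSpace (NonemptyCompacts ℂ)] in
/-- **One collar family gives almost sure avoidance of its arc.**  If `μ` is a law carried by
`{range ⊆ cl D}` with the SLE(8/3) hull-avoidance values through `φ`, (H1) holds for `ν`, and
`Kset ⊆ cl ℍ` carries collar data with derivative numbers `d_j → 1`, then
`ν {K ∩ ψ(Kset) = ∅} = 1`. [cite: LawlerSchrammWerner2003Restriction, Thm. 6.1 and §2 p. 8, transposed] -/
theorem measure_setOf_disjoint_image_eq_one (hφ : D.IsChordalUniformizing φ)
    {Ψ : ℂ → ℂ} (hdisc : JordanDomain.IsDiscExtension D.toJordanDomain φ Ψ)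
    {μ : Measure (CurveClass ℂ)} (hμD : ∀ᵐ c ∂μ, c.range ⊆ closure D.carrier)
    (hμav : ∀ (A : Set ℂ) (Φ : ConformalEquiv (upperHalfPlaneSet \ A) upperHalfPlaneSet) (d : ℝ),
      IsStarHull A → IsRestrictionMap A Φ → HasRestrictionDeriv A Φ d →
      μ (CurveClass.rangeSubset (φ.boundaryExtension '' A)ᶜ) = ENNReal.ofReal (d ^ ((5 : ℝ) / 8)))
    {ν : Measure (NonemptyCompacts ℂ)} [IsProbabilityMeasure ν]
    (H1 : ∀ D' : DobrushinDomain, D.IsHullSubdomain D' →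
      μ (CurveClass.rangeSubset (closure D'.carrier)) ≤ ν {K | (K : Set ℂ) ⊆ closure D'.carrier})
    {Kset : Set ℂ} (hKim : ∀ z ∈ Kset, 0 ≤ z.im) {d : ℕ → ℝ} (hd : Tendsto d atTop (𝓝 1))
    (hdata : ∀ j : ℕ, ∃ (J N : Set ℂ) (Φ : ConformalEquiv (upperHalfPlaneSet \ J) upperHalfPlaneSet),
      IsArcHull J ∧ (0 : ℂ) ∉ J ∧ IsRestrictionMap J Φ ∧ HasRestrictionDeriv J Φ (d j) ∧
      IsOpen N ∧ (∀ z ∈ N, 0 ≤ z.im → z ∈ J) ∧ Kset ⊆ N) :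
    ν {K : NonemptyCompacts ℂ | Disjoint (K : Set ℂ) (φ.boundaryExtension '' Kset)} = 1 := by
  refine le_antisymm prob_le_one ?_
  -- the lower bounds `d_j ^ (5/8)`
  have hlow : ∀ j, ENNReal.ofReal (d j ^ ((5 : ℝ) / 8)) ≤
      ν {K : NonemptyCompacts ℂ | Disjoint (K : Set ℂ) (φ.boundaryExtension '' Kset)} := by
    intro j
    obtain ⟨J, N, Φ, hJ, h0J, hΦ, hdj, hN, hNJ, hK⟩ := hdata j
    obtain ⟨D', Ψ', hD', hΨ', hΨ'd, hdisj⟩ :=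
      exists_hullSubdomain_collar hφ hdisc hJ h0J hΦ hdj hN hNJ hK hKim
    have hA : IsStarHull (φ.pullbackHull D') :=
      IsStarHull.pullbackHull JordanDomain.isSimplyConnected_holds hφ hD'
    calc ENNReal.ofReal (d j ^ ((5 : ℝ) / 8))
        = μ (CurveClass.rangeSubset (φ.boundaryExtension '' φ.pullbackHull D')ᶜ) :=
          (hμav _ Ψ' _ hA hΨ' hΨ'd).symm
      _ ≤ μ (CurveClass.rangeSubset (closure D'.carrier)) := by
          refine measure_mono_ae ?_
          filter_upwards [hμD] with c hcD hc
          exact rangeSubset_compl_image_pullbackHull_subset hφ hD' ⟨hc, hcD⟩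
      _ ≤ ν {K | (K : Set ℂ) ⊆ closure D'.carrier} := H1 D' hD'
      _ ≤ ν {K : NonemptyCompacts ℂ | Disjoint (K : Set ℂ) (φ.boundaryExtension '' Kset)} :=
          measure_mono fun K (hK : (K : Set ℂ) ⊆ closure D'.carrier) => hdisj.mono_left hK
  have hlim : Tendsto (fun j => ENNReal.ofReal (d j ^ ((5 : ℝ) / 8))) atTop (𝓝 1) := by
    have h1 := hd.rpow_const (p := (5 : ℝ) / 8) (Or.inl one_ne_zero)
    rw [Real.one_rpow] at h1
    rw [← ENNReal.ofReal_one]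
    exact ENNReal.tendsto_ofReal h1
  exact le_of_tendsto' hlim hlow

/-- **Boundary avoidance of the limit sets** (module docstring): under (H1) against the SLE(8/3)
law `μ` through `φ`, `ν`-a.e. compact set meets `∂D` only inside `{a, b}`.
[cite: LawlerSchrammWerner2003Restriction, Thm. 6.1, Lemma 3.2 and §2 p. 8, transposed] -/
theorem ae_inter_frontier_subset (hφ : D.IsChordalUniformizing φ)
    {μ : Measure (CurveClass ℂ)} (hμD : ∀ᵐ c ∂μ, c.range ⊆ closure D.carrier)
    (hμav : ∀ (A : Set ℂ) (Φ : ConformalEquiv (upperHalfPlaneSet \ A) upperHalfPlaneSet) (d : ℝ),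
      IsStarHull A → IsRestrictionMap A Φ → HasRestrictionDeriv A Φ d →
      μ (CurveClass.rangeSubset (φ.boundaryExtension '' A)ᶜ) = ENNReal.ofReal (d ^ ((5 : ℝ) / 8)))
    {ν : Measure (NonemptyCompacts ℂ)} [IsProbabilityMeasure ν]
    (H1 : ∀ D' : DobrushinDomain, D.IsHullSubdomain D' →
      μ (CurveClass.rangeSubset (closure D'.carrier)) ≤ ν {K | (K : Set ℂ) ⊆ closure D'.carrier}) :
    ∀ᵐ (K : NonemptyCompacts ℂ) ∂ν, (K : Set ℂ) ∩ frontier D.carrier ⊆ {D.pt 0, D.pt 1} := by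
  obtain ⟨Ψ, hdisc⟩ :=
    JordanDomain.exists_isDiscExtension JordanDomain.exists_continuousOn_extension_holds φ
  have him : ∀ u v : ℝ, ∀ z ∈ (fun x : ℝ => (x : ℂ)) '' Icc u v, 0 ≤ z.im := by
    rintro u v _ ⟨x, -, rfl⟩; simp
  -- each boundary piece is almost surely avoided
  have hpiece : ∀ k : ℕ, ∀ᵐ (K : NonemptyCompacts ℂ) ∂ν, Disjoint (K : Set ℂ) (frontierPiece D k) := by
    intro k
    obtain ⟨r, R, hr, hrR, hcov⟩ := exists_Icc_cover_frontierPiece hdisc hφ k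
    obtain ⟨d, hd, hdata⟩ := exists_plusData hr hrR
    have h1 := measure_setOf_disjoint_image_eq_one hφ hdisc hμD hμav H1 (him r R) hd hdata
    have h2 := measure_setOf_disjoint_image_eq_one hφ hdisc hμD hμav H1 (him (-R) (-r)) hd
      fun j => by
        rw [← imagAxisRefl_image_ofReal_Icc r R]
        exact reflect_data (hdata j)
    have hmeas : ∀ S : Set ℂ, IsCompact S →
        MeasurableSet {K : NonemptyCompacts ℂ | Disjoint (K : Set ℂ) S} := fun S hS =>
      (Literature.MeasureTheory.RandomSets.isOpen_setOf_disjoint_of_isClosed hS.isClosed).measurableSet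
    have hcpt : ∀ u v : ℝ, IsCompact (φ.boundaryExtension '' ((fun x : ℝ => (x : ℂ)) '' Icc u v)) :=
      fun u v => MarkedDomain.isCompact_image_boundaryExtension
        JordanDomain.exists_continuousOn_extension_holds
        (fun z hz => mem_closure_upperHalfPlaneSet_iff.2 (him u v z hz))
        (isCompact_Icc.image continuous_ofReal)
    have h1' : ∀ᵐ (K : NonemptyCompacts ℂ) ∂ν,
        Disjoint (K : Set ℂ) (φ.boundaryExtension '' ((fun x : ℝ => (x : ℂ)) '' Icc r R)) := by
      rw [ae_iff]
      exact (prob_compl_eq_zero_iff (hmeas _ (hcpt r R))).2 h1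
    have h2' : ∀ᵐ (K : NonemptyCompacts ℂ) ∂ν,
        Disjoint (K : Set ℂ) (φ.boundaryExtension '' ((fun x : ℝ => (x : ℂ)) '' Icc (-R) (-r))) := by
      rw [ae_iff]
      exact (prob_compl_eq_zero_iff (hmeas _ (hcpt (-R) (-r)))).2 h2
    filter_upwards [h1', h2'] with K hK1 hK2
    exact (Disjoint.union_right hK1 hK2).mono_right hcov
  rw [← ae_all_iff] at hpiece
  filter_upwards [hpiece] with K hK
  rintro w ⟨hwK, hwfr⟩
  by_contra hab
  simp only [mem_insert_iff, mem_singleton_iff, not_or] at hab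
  have hda : 0 < dist w (D.pt 0) := dist_pos.2 hab.1
  have hdb : 0 < dist w (D.pt 1) := dist_pos.2 hab.2
  obtain ⟨k, hk⟩ := exists_nat_one_div_lt (lt_min hda hdb)
  refine Set.disjoint_left.1 (hK k) hwK ⟨hwfr, ?_⟩
  rintro (h | h) <;> rw [mem_ball] at h
  · linarith [min_le_left (dist w (D.pt 0)) (dist w (D.pt 1))]
  · linarith [min_le_right (dist w (D.pt 0)) (dist w (D.pt 1))]

end Boundary

/-! ### Registered form (part 2c of `stub_rangeIdentification`) -/

/-- **Registered helper `rangeIdentification_boundary`** (crux item stmt-CriticalPhenomena-0808,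
line `root-locality-replaces-loewner`, stub `stub_rangeIdentification`, part 2c): boundary
avoidance off the marked points for every probability law `ν` on `NonemptyCompacts ℂ` dominating,
on the hull events `{K ⊆ cl D'}`, the hull probabilities of a law `μ` on curve classes carried by
`{range ⊆ cl D}` having the SLE(8/3) hull-avoidance values `Φ'_A(0)^{5/8}` through a chordal
uniformizing map (collar hull subdomains of thin half-ellipse hulls, `Φ'_A(0) → 1`).
[cite: LawlerSchrammWerner2003Restriction, Thm. 6.1, Lemma 3.2 and §2 p. 8, transposed] -/
theorem rangeIdentification_boundary : ∀ [MeasurableSpace (TopologicalSpace.NonemptyCompacts ℂ)] [BorelSpace (TopologicalSpace.NonemptyCompacts ℂ)] (D : Literature.Probability.RandomPlanarGeometry.DobrushinDomain) (φ : Literature.Probability.RandomPlanarGeometry.ConformalEquiv UpperHalfPlane.upperHalfPlaneSet D.carrier) (μ : MeasureTheory.Measure (Literature.Probability.RandomPlanarGeometry.CurveClass ℂ)) (ν : MeasureTheory.Measure (TopologicalSpace.NonemptyCompacts ℂ)), MeasureTheory.IsProbabilityMeasure ν → D.IsChordalUniformizing φ → (∀ᵐ c ∂μ, Literature.Probability.RandomPlanarGeometry.CurveClass.range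 c ⊆ closure D.carrier) → (∀ (A : Set ℂ) (Φ : Literature.Probability.RandomPlanarGeometry.ConformalEquiv (UpperHalfPlane.upperHalfPlaneSet \ A) UpperHalfPlane.upperHalfPlaneSet) (d : ℝ), Literature.Probability.RandomPlanarGeometry.IsStarHull A → Literature.Probability.RandomPlanarGeometry.IsRestrictionMap A Φ → Literature.Probability.RandomPlanarGeometry.HasRestrictionDeriv A Φ d → μ (Literature.Probability.RandomPlanarGeometry.CurveClass.rangeSubset (φ.boundaryExtension '' A)ᶜ) = ENNReal.ofReal (d ^ ((5 : ℝ) / 8))) → (∀ D' : Literature.Probability.RandomPlanarGeometry.DobrushinDomain, D.IsHullSubdomain D' → μ (Literature.Probability.RandomPlanarGeometry.CurveClass.rangeSubset (closure D'.carrier)) ≤ ν {K | (K : Set ℂ) ⊆ closure D'.carrier}) → ∀ᵐ (K : TopologicalSpace.NonemptyCompacts ℂ) ∂ν, (K : Set ℂ) ∩ frontier D.carrier ⊆ {D.pt 0, D.pt 1} :=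
  fun _ _ _ _ hν hφ hμD hμav H1 => by
    haveI := hν
    exact ae_inter_frontier_subset hφ hμD hμav H1

end Summit.CriticalPhenomena.SAWScalingLimit.Theorems.HexConjecture.RootLocality.Range

end
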